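import Mathlib
import Summits.Ventures.PercRepro2.TwoHullMasterOut

/-!
# The rigid two-hull master statement gives the vertex form (blind cell PercRepro2, night-4 g39,
2026-08-29; proofs/NIGHT4-G39.md §6)

The hull pair `(C_R(h), C_B(h))` is a monotone function of the rigid pair
`(redEdges, blueEdges)` — a cluster is its centre together with the ends of its edges
(`cluster_eq_insert_ends_redEdges`) — so every up-set of vertex pairs pulls back to an up-set of
edge pairs, compatibly with the mirror, and the rigid (MM) implies the vertex (MM), with or
without a region: **`twoHullMaster_of_rigid`**, **`twoHullMasterOut_of_rigidOut`**.  Hence the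
rigid forms are the statements of record.
-/

namespace Summit.Ventures.PercRepro2

namespace LocRows

open Hull

variable {V : Type*} {E : Type*} [Fintype E] [DecidableEq E]

open scoped Classical

variable (ends : E → Sym2 V)

/-- The vertices spanned by an edge set together with a centre. -/
def vertsOf (F : Set E) (x : V) : Set V := insert x {y | ∃ e ∈ F, y ∈ ends e}

/-- The pull-back of a set of vertex pairs to edge pairs through `vertsOf`. -/
def pullPairs (𝓦 : Set (Set V × Set V)) (x : V) : Set (Set E × Set E) :=
  {p | (vertsOf ends p.1 x, vertsOf ends p.2 x) ∈ 𝓦}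

variable {ends}

omit [Fintype E] [DecidableEq E] in
/-- `vertsOf` is monotone. -/
lemma vertsOf_mono {F F' : Set E} (hF : F ⊆ F') (x : V) : vertsOf ends F x ⊆ vertsOf ends F' x := by
  rintro y (rfl | ⟨e, he, hy⟩)
  · exact Set.mem_insert _ _
  · exact Set.mem_insert_of_mem _ ⟨e, hF he, hy⟩

omit [Fintype E] [DecidableEq E] in
/-- The hull pair is the image of the rigid pair. -/
lemma hullPair_eq_vertsOf (ζ : Config E) (x : V) :
    hullPair ends ζ x = (vertsOf ends (edgePair ends ζ x).1 x, vertsOf ends (edgePair ends ζ x).2 x) := by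
  simp only [hullPair, edgePair, vertsOf]
  rw [cluster_eq_insert_ends_redEdges ζ x, cluster_eq_insert_ends_redEdges (blue ζ) x]
  rfl

omit [Fintype E] [DecidableEq E] in
/-- The pull-back of an up-set of vertex pairs is an up-set of edge pairs. -/
lemma isPairUpSetE_pullPairs {𝓦 : Set (Set V × Set V)} (h𝓦 : IsPairUpSet 𝓦) (x : V) :
    IsPairUpSetE (pullPairs ends 𝓦 x) := by
  intro A A' B B' hA hB hAB
  exact h𝓦 _ _ _ _ (vertsOf_mono hA x) (vertsOf_mono hB x) hAB

omit [Fintype E] [DecidableEq E] in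
/-- The pull-back commutes with the mirror. -/
lemma pullPairs_mirror (𝓦 : Set (Set V × Set V)) (x : V) :
    pullPairs ends (mirror 𝓦) x = mirror (pullPairs ends 𝓦 x) := by
  ext p
  simp only [pullPairs, mirror, Set.mem_setOf_eq]

/-- The vertex two-hull class is the rigid class of the pull-back. -/
lemma twoHullClass_eq_twoHullClassE_pullPairs (l h : V) (𝓦l 𝓦h : Set (Set V × Set V)) :
    twoHullClass ends l h 𝓦l 𝓦h = twoHullClassE ends l h 𝓦l (pullPairs ends 𝓦h h) := by
  ext ζ
  rw [mem_twoHullClass, mem_twoHullClassE]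
  simp only [pullPairs, Set.mem_setOf_eq, hullPair_eq_vertsOf ζ h]

/-- **The rigid (MM) gives the vertex (MM).** -/
theorem twoHullMaster_of_rigid {l h : V} (hm : TwoHullMasterRigid ends l h) :
    TwoHullMaster ends l h := by
  intro 𝓦l 𝓦h h𝓦l h𝓦h
  rw [twoHullClass_eq_twoHullClassE_pullPairs, twoHullClass_eq_twoHullClassE_pullPairs,
    pullPairs_mirror]
  exact hm _ _ h𝓦l (isPairUpSetE_pullPairs h𝓦h h)

/-- The regioned vertex class is the regioned rigid class of the pull-back. -/
lemma twoHullClassOut_eq_twoHullClassEOut_pullPairs (l h : V) (𝓦l 𝓦h : Set (Set V × Set V))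
    (U : Set V) (ξ : Config E) :
    twoHullClassOut ends l h 𝓦l 𝓦h U ξ =
      twoHullClassEOut ends l h 𝓦l (pullPairs ends 𝓦h h) U ξ := by
  simp only [twoHullClassOut, twoHullClassEOut, twoHullClass_eq_twoHullClassE_pullPairs]

/-- **The regioned rigid (MM) gives the regioned vertex (MM).** -/
theorem twoHullMasterOut_of_rigidOut {l h : V} (hm : TwoHullMasterRigidOut ends l h) :
    TwoHullMasterOut ends l h := by
  intro 𝓦l 𝓦h U ξ h𝓦l h𝓦h hU hl
  rw [twoHullClassOut_eq_twoHullClassEOut_pullPairs, twoHullClassOut_eq_twoHullClassEOut_pullPairs,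
    pullPairs_mirror]
  exact hm _ _ U ξ h𝓦l (isPairUpSetE_pullPairs h𝓦h h) hU hl

end LocRows

end Summit.Ventures.PercRepro2
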